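import Summits.QuantumFields.YangMills.Theorems.FemtoTransferGapSlabRayleigh
import Summits.QuantumFields.YangMills.Theorems.FemtoTransferGapSlabGround
import Summits.QuantumFields.YangMills.Theorems.FemtoTransferGapBounds
import Summits.QuantumFields.YangMills.Theorems.FemtoTransferGapPositivity
import Summits.QuantumFields.YangMills.Theorems.LuscherReductionRunningReductionKTPhysSpace
import Literature.Analysis.OperatorTheory.PositiveKernelTransferOperator
import Literature.Analysis.OperatorTheory.PositivityImproving

/-!
# The physical subspace of `L²(configMeasure)` and the zero-flux transfer operator as a compact self-adjoint
# positive operator on it (fixed lattice `(ℤ/L)³`, `SU(2)`)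

Fleet-service module of seat ym-infvol-p2 g4 (route `LuscherReduction`, crux RED `stmt-QuantumFields-19978`, line «KTR»): step 1
of the SPECTRAL ATTAINMENT bridge announced in `Theorems/LuscherReductionRunningReductionKTRCalibration.lean` (p492709) — the
hypothesis `hatt` there (exact `l2`-orthonormal physical eigenfunctions realising `levelValue`) is to be DISCHARGED from the tree's
compact-operator layer (`Literature/Analysis/OperatorTheory/PositiveKernelTransferOperator.lean`, `CompactCompression.lean`,
`CompactPositiveMinMaxLevels.lean`).  This file builds the Hilbert-space side of the dictionary:

* §1 `toL2` — a physical zero-flux test function (`physSubmodule L`, tree) as an element of the real Hilbert space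
  `Lp ℝ 2 (configMeasure SU2 L)`; `⟪toL2 ψ, toL2 φ⟫ = l2 ψ φ`, `‖toL2 ψ‖² = l2 ψ ψ`.
* §2 `physCore L` (= range of `toL2`, the dense core) and `physL2 L` (its topological closure: the PHYSICAL CLOSED SUBSPACE).
* §3 the kernel operator `A` of `transferKernel su2Rep β` on `L²` (Lit `exists_kernelOp`: compact, self-adjoint):
  `A (toL2 ψ) = toL2 (K_β ψ)`, `A` leaves `physL2 L` invariant, `⟪toL2 ψ, A (toL2 φ)⟫ = qform ψ φ`, and `0 ≤ ⟪v, A v⟫` on `physL2 L`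
  for `β ≥ 0` (density + `qform_su2Rep_self_nonneg`).
* §4 every class in `physL2 L` is a.e. invariant under gauge transformations and centre twists (the fixed space of the `L²`-isometry
  `Lp.compMeasurePreserving` is closed and contains the core), hence **`isPhys_transferApply_coe`**: for `v ∈ physL2 L` the
  everywhere-defined function `U ↦ ∫ K_β(U,V) v(V) dV` is a physical zero-flux test function, and its class is `A v`.

HONEST FRAMING: fixed-lattice functional analysis (Reed–Simon I §VI.5–6) over tree objects; femto rung R2b1 infrastructure; no
renormalisation-group content; nothing here bears on infinite volume, the continuum limit or the Clay gap.
-/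

set_option autoImplicit false

noncomputable section

open MeasureTheory Filter Topology Real
open Literature.MathematicalPhysics.QuantumFieldTheory
open Literature.MathematicalPhysics.QuantumLattice
open Literature.Analysis.OperatorTheory.YMMatrixModel
open Literature.Analysis.OperatorTheory
open scoped InnerProductSpace BigOperators

namespace Summit.QuantumFields.YangMills.Theorems.FemtoTransferGap.PhysL2

open Summit.QuantumFields.YangMills.Theorems.FemtoTransferGap

variable {L : ℕ} [NeZero L]

/-! ## §1 Physical test functions as `L²` classes -/

/-- A physical zero-flux test function is in `L²(configMeasure)` (bounded and measurable on a probability space). [folklore] -/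
theorem memLp_two_of_isPhys {ψ : GaugeConfig 3 L SU2 → ℝ} (hψ : IsPhys ψ) : MemLp ψ 2 (configMeasure SU2 L) := by
  obtain ⟨C, hC⟩ := hψ.bounded
  exact MemLp.of_bound hψ.measurable.aestronglyMeasurable C (ae_of_all _ fun U => by rw [Real.norm_eq_abs]; exact hC U)

/-- The `L²` class of a physical test function. [folklore] -/
def toL2Fun (ψ : physSubmodule L) : Lp ℝ 2 (configMeasure SU2 L) :=
  (memLp_two_of_isPhys (isPhys_coe ψ)).toLp (ψ : GaugeConfig 3 L SU2 → ℝ)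

/-- The class of `ψ` is a.e. equal to `ψ`. [folklore] -/
theorem coeFn_toL2Fun (ψ : physSubmodule L) :
    (toL2Fun ψ : GaugeConfig 3 L SU2 → ℝ) =ᵐ[configMeasure SU2 L] (ψ : GaugeConfig 3 L SU2 → ℝ) :=
  MemLp.coeFn_toLp _

/-- **`toL2`: the physical subspace → `L²(configMeasure)`, linearly.** [cite: ReedSimonIV1978, Thm. XIII.1] -/
def toL2 : physSubmodule L →ₗ[ℝ] Lp ℝ 2 (configMeasure SU2 L) where
  toFun := toL2Fun
  map_add' ψ φ := by
    apply Lp.ext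
    filter_upwards [coeFn_toL2Fun (ψ + φ), coeFn_toL2Fun ψ, coeFn_toL2Fun φ,
      Lp.coeFn_add (toL2Fun ψ) (toL2Fun φ)] with U h1 h2 h3 h4
    rw [h1, h4, Pi.add_apply, h2, h3, Submodule.coe_add, Pi.add_apply]
  map_smul' c ψ := by
    apply Lp.ext
    filter_upwards [coeFn_toL2Fun (c • ψ), coeFn_toL2Fun ψ, Lp.coeFn_smul c (toL2Fun ψ)] with U h1 h2 h3
    rw [h1, RingHom.id_apply, h3, Pi.smul_apply, h2, Submodule.coe_smul, Pi.smul_apply]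

/-- `toL2 ψ =ᵐ ψ`. [folklore] -/
theorem coeFn_toL2 (ψ : physSubmodule L) :
    (toL2 ψ : GaugeConfig 3 L SU2 → ℝ) =ᵐ[configMeasure SU2 L] (ψ : GaugeConfig 3 L SU2 → ℝ) :=
  coeFn_toL2Fun ψ

/-- **`⟪toL2 ψ, toL2 φ⟫ = l2 ψ φ`.** [folklore] -/
theorem inner_toL2 (ψ φ : physSubmodule L) :
    ⟪toL2 ψ, toL2 φ⟫_ℝ = l2 (ψ : GaugeConfig 3 L SU2 → ℝ) φ := by
  rw [inner_eq_integral]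
  unfold l2
  refine integral_congr_ae ?_
  filter_upwards [coeFn_toL2 ψ, coeFn_toL2 φ] with U h1 h2
  rw [h1, h2]

/-- `‖toL2 ψ‖² = l2 ψ ψ`. [folklore] -/
theorem norm_sq_toL2 (ψ : physSubmodule L) : ‖toL2 ψ‖ ^ 2 = l2 (ψ : GaugeConfig 3 L SU2 → ℝ) ψ := by
  rw [← real_inner_self_eq_norm_sq, inner_toL2]

/-- `⟪toL2 ψ, v⟫ = ∫ ψ v`. [folklore] -/
theorem inner_toL2_left (ψ : physSubmodule L) (v : Lp ℝ 2 (configMeasure SU2 L)) :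
    ⟪toL2 ψ, v⟫_ℝ = ∫ U, (ψ : GaugeConfig 3 L SU2 → ℝ) U * v U ∂configMeasure SU2 L := by
  rw [inner_eq_integral]
  refine integral_congr_ae ?_
  filter_upwards [coeFn_toL2 ψ] with U h1
  rw [h1]

/-! ## §2 The physical core and the physical closed subspace of `L²` -/

variable (L) in
/-- **The physical core**: the classes of physical zero-flux test functions (a subspace of `L²`). [cite: ReedSimonIV1978, Thm. XIII.2] -/
def physCore : Submodule ℝ (Lp ℝ 2 (configMeasure SU2 L)) := LinearMap.range (toL2 (L := L))

variable (L) in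
/-- **The physical closed subspace of `L²(configMeasure)`**: the closure of the core. [cite: ReedSimonIV1978, Thm. XIII.2] -/
def physL2 : Submodule ℝ (Lp ℝ 2 (configMeasure SU2 L)) := (physCore L).topologicalClosure

/-- `toL2 ψ` lies in the core. [folklore] -/
theorem toL2_mem_physCore (ψ : physSubmodule L) : toL2 ψ ∈ physCore L := LinearMap.mem_range_self _ ψ

/-- Core elements are classes of physical test functions. [folklore] -/
theorem mem_physCore_iff {v : Lp ℝ 2 (configMeasure SU2 L)} : v ∈ physCore L ↔ ∃ ψ : physSubmodule L, toL2 ψ = v :=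
  LinearMap.mem_range

/-- The core lies in the closed subspace. [folklore] -/
theorem physCore_le_physL2 : physCore L ≤ physL2 L := Submodule.le_topologicalClosure _

/-- `toL2 ψ` lies in the physical closed subspace. [folklore] -/
theorem toL2_mem_physL2 (ψ : physSubmodule L) : toL2 ψ ∈ physL2 L := physCore_le_physL2 (toL2_mem_physCore ψ)

/-- The physical closed subspace is closed. [folklore] -/
theorem isClosed_physL2 : IsClosed (physL2 L : Set (Lp ℝ 2 (configMeasure SU2 L))) :=
  Submodule.isClosed_topologicalClosure _

/-- As a set, the physical closed subspace is the closure of the core. [folklore] -/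
theorem coe_physL2 : (physL2 L : Set (Lp ℝ 2 (configMeasure SU2 L))) = closure (physCore L : Set (Lp ℝ 2 (configMeasure SU2 L))) :=
  Submodule.topologicalClosure_coe _

/-- **Closure induction**: a closed property holding on the core holds on the physical closed subspace. [folklore] -/
theorem physL2_induction {S : Set (Lp ℝ 2 (configMeasure SU2 L))} (hS : IsClosed S)
    (hcore : ∀ ψ : physSubmodule L, toL2 ψ ∈ S) {v : Lp ℝ 2 (configMeasure SU2 L)} (hv : v ∈ physL2 L) : v ∈ S := by
  have hsub : (physCore L : Set (Lp ℝ 2 (configMeasure SU2 L))) ⊆ S := by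
    rintro w ⟨ψ, rfl⟩
    exact hcore ψ
  have hv' : v ∈ closure (physCore L : Set (Lp ℝ 2 (configMeasure SU2 L))) := by
    rw [← coe_physL2]; exact hv
  exact closure_minimal hsub hS hv'

/-! ## §3 The kernel operator of `K_β` on `L²` and its restriction to the physical subspace -/

/-- Joint strong measurability of the `SU(2)` transfer kernel (it is continuous). [folklore] -/
theorem stronglyMeasurable_transferKernel (β : ℝ) :
    StronglyMeasurable (Function.uncurry fun U V : GaugeConfig 3 L SU2 => transferKernel su2Rep β U V) := by
  haveI : SecondCountableTopology SU2 := secondCountableTopology_su2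
  exact (continuous_transferKernel su2Rep continuous_su2Rep β (L := L)).stronglyMeasurable

/-- A norm bound for the `SU(2)` transfer kernel: `‖K_β(U,V)‖ ≤ M` with `0 ≤ M`. [folklore] -/
theorem exists_norm_transferKernel_le (β : ℝ) :
    ∃ M : ℝ, 0 ≤ M ∧ ∀ U V : GaugeConfig 3 L SU2, ‖transferKernel su2Rep β U V‖ ≤ M := by
  obtain ⟨M, hM⟩ := exists_transferKernel_le su2Rep continuous_su2Rep β (L := L)
  have h1 : ∀ U V : GaugeConfig 3 L SU2, ‖transferKernel su2Rep β U V‖ ≤ M := fun U V => by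
    rw [Real.norm_of_nonneg (transferKernel_pos su2Rep β U V).le]; exact hM U V
  exact ⟨M, (norm_nonneg _).trans (h1 (fun _ => 1) (fun _ => 1)), h1⟩

/-- **The transfer operator on `L²(configMeasure)`**: a compact self-adjoint bounded operator `A` with
`(A v)(U) = ∫ K_β(U,V) v(V) dV` a.e. (Lit `exists_kernelOp`, `isSelfAdjoint_kernelOp`, `isCompactOperator_kernelOp`).
[cite: ReedSimonI1980, Thm. VI.23] -/
theorem exists_transferOpL2 (β : ℝ) :
    ∃ A : Lp ℝ 2 (configMeasure SU2 L) →L[ℝ] Lp ℝ 2 (configMeasure SU2 L),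
      (∀ v : Lp ℝ 2 (configMeasure SU2 L),
        (A v : GaugeConfig 3 L SU2 → ℝ) =ᵐ[configMeasure SU2 L] fun U => ∫ V, transferKernel su2Rep β U V * v V ∂configMeasure SU2 L) ∧
      IsSelfAdjoint A ∧ IsCompactOperator A := by
  obtain ⟨M, hM0, hM⟩ := exists_norm_transferKernel_le (L := L) β
  obtain ⟨A, hA⟩ := exists_kernelOp (μ := configMeasure SU2 L) (stronglyMeasurable_transferKernel β) hM
  exact ⟨A, hA, isSelfAdjoint_kernelOp (stronglyMeasurable_transferKernel β) hM (transferKernel_su2Rep_symm β) hA,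
    isCompactOperator_kernelOp hM hM0 hA⟩

section Operator

variable {β : ℝ} {A : Lp ℝ 2 (configMeasure SU2 L) →L[ℝ] Lp ℝ 2 (configMeasure SU2 L)}
  (hA : ∀ v : Lp ℝ 2 (configMeasure SU2 L),
    (A v : GaugeConfig 3 L SU2 → ℝ) =ᵐ[configMeasure SU2 L] fun U => ∫ V, transferKernel su2Rep β U V * v V ∂configMeasure SU2 L)
include hA

omit hA in
/-- The kernel integral against an `L²` class IS `transferApply` of (the representative of) the class, pointwise. [folklore] -/
theorem transferApply_coe_eq (v : Lp ℝ 2 (configMeasure SU2 L)) (U : GaugeConfig 3 L SU2) :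
    transferApply β (v : GaugeConfig 3 L SU2 → ℝ) U = ∫ V, transferKernel su2Rep β U V * v V ∂configMeasure SU2 L := rfl

omit hA in
/-- a.e.-equal inputs give EQUAL kernel integrals (everywhere). [folklore] -/
theorem transferApply_congr_ae {f g : GaugeConfig 3 L SU2 → ℝ} (h : f =ᵐ[configMeasure SU2 L] g) :
    transferApply β f = transferApply β g := by
  funext U
  rw [transferApply_apply, transferApply_apply]
  refine integral_congr_ae ?_
  filter_upwards [h] with V hV
  rw [hV]

/-- **`A (toL2 ψ) = toL2 (K_β ψ)`**: on the core, the `L²` operator is the tree's `transferApply`. [folklore] -/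
theorem apply_toL2 (ψ : physSubmodule L) : A (toL2 ψ) = toL2 (transferOp β ψ) := by
  apply Lp.ext
  filter_upwards [hA (toL2 ψ), coeFn_toL2 (transferOp β ψ)] with U h1 h2
  rw [h1, h2, coe_transferOp, ← transferApply_coe_eq, transferApply_congr_ae (coeFn_toL2 ψ)]

/-- The `L²` operator maps the core into the core. [folklore] -/
theorem apply_mem_physCore {v : Lp ℝ 2 (configMeasure SU2 L)} (hv : v ∈ physCore L) : A v ∈ physCore L := by
  obtain ⟨ψ, rfl⟩ := mem_physCore_iff.mp hv
  rw [apply_toL2 hA]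
  exact toL2_mem_physCore _

/-- **The `L²` operator leaves the physical closed subspace invariant** (continuity). [folklore] -/
theorem apply_mem_physL2 {v : Lp ℝ 2 (configMeasure SU2 L)} (hv : v ∈ physL2 L) : A v ∈ physL2 L := by
  have hS : IsClosed (A ⁻¹' (physL2 L : Set (Lp ℝ 2 (configMeasure SU2 L)))) := isClosed_physL2.preimage A.continuous
  exact physL2_induction hS (fun ψ => physCore_le_physL2 (apply_mem_physCore hA (toL2_mem_physCore ψ))) hv

/-- **`⟪toL2 ψ, A (toL2 φ)⟫ = ⟨ψ, K_β φ⟩ = qform ψ φ`.** [cite: ReedSimonIV1978, Thm. XIII.1] -/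
theorem inner_apply_toL2 (ψ φ : physSubmodule L) :
    ⟪toL2 ψ, A (toL2 φ)⟫_ℝ = qform su2Rep β (ψ : GaugeConfig 3 L SU2 → ℝ) φ := by
  rw [apply_toL2 hA, inner_toL2, coe_transferOp, qform_eq_l2_transferApply]

/-- **Positivity on the physical closed subspace**: `0 ≤ ⟪v, A v⟫` for `v ∈ physL2 L`, `β ≥ 0` (density from
`qform_su2Rep_self_nonneg`). [cite: OsterwalderSeiler1978, §2] -/
theorem inner_apply_nonneg (hβ : 0 ≤ β) {v : Lp ℝ 2 (configMeasure SU2 L)} (hv : v ∈ physL2 L) : 0 ≤ ⟪v, A v⟫_ℝ := by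
  have hS : IsClosed {w : Lp ℝ 2 (configMeasure SU2 L) | 0 ≤ ⟪w, A w⟫_ℝ} :=
    isClosed_le continuous_const (continuous_id.inner A.continuous)
  refine physL2_induction hS (fun ψ => ?_) hv
  show 0 ≤ ⟪toL2 ψ, A (toL2 ψ)⟫_ℝ
  rw [inner_apply_toL2 hA]
  exact qform_su2Rep_self_nonneg hβ (isPhys_coe ψ)

end Operator

/-! ## §4 a.e. gauge/twist invariance of physical classes; physical representatives -/

/-- A class in the physical closed subspace is a.e. invariant under any measure-preserving symmetry `T` that fixes every physical
test function (gauge transformations, centre twists). [folklore] -/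
theorem ae_comp_eq_of_mem_physL2 {T : GaugeConfig 3 L SU2 → GaugeConfig 3 L SU2}
    (hT : MeasurePreserving T (configMeasure SU2 L) (configMeasure SU2 L))
    (hfix : ∀ ψ : GaugeConfig 3 L SU2 → ℝ, IsPhys ψ → ∀ U, ψ (T U) = ψ U)
    {v : Lp ℝ 2 (configMeasure SU2 L)} (hv : v ∈ physL2 L) :
    (fun U => (v : GaugeConfig 3 L SU2 → ℝ) (T U)) =ᵐ[configMeasure SU2 L] (v : GaugeConfig 3 L SU2 → ℝ) := by
  set σ := Lp.compMeasurePreserving (E := ℝ) (p := 2) T hT with hσ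
  have hcont : Continuous (σ : Lp ℝ 2 (configMeasure SU2 L) → Lp ℝ 2 (configMeasure SU2 L)) :=
    (Lp.isometry_compMeasurePreserving (E := ℝ) (p := 2) hT).continuous
  have hS : IsClosed {w : Lp ℝ 2 (configMeasure SU2 L) | σ w = w} := isClosed_eq hcont continuous_id
  have hcore : ∀ ψ : physSubmodule L, toL2 ψ ∈ {w : Lp ℝ 2 (configMeasure SU2 L) | σ w = w} := by
    intro ψ
    show σ (toL2 ψ) = toL2 ψ
    apply Lp.ext
    have h1 := Lp.coeFn_compMeasurePreserving (toL2 ψ) hT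
    have h2 : (toL2 ψ : GaugeConfig 3 L SU2 → ℝ) ∘ T =ᵐ[configMeasure SU2 L] (ψ : GaugeConfig 3 L SU2 → ℝ) ∘ T :=
      hT.quasiMeasurePreserving.ae_eq_comp (coeFn_toL2 ψ)
    have h3 : (ψ : GaugeConfig 3 L SU2 → ℝ) ∘ T = (ψ : GaugeConfig 3 L SU2 → ℝ) :=
      funext fun U => hfix _ (isPhys_coe ψ) U
    filter_upwards [h1, h2, coeFn_toL2 ψ] with U hU1 hU2 hU3
    rw [hU1, hU2, h3, hU3]
  have hfixv : σ v = v := physL2_induction hS hcore hv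
  have h1 := Lp.coeFn_compMeasurePreserving v hT
  rw [hfixv] at h1
  filter_upwards [h1] with U hU
  exact hU.symm

/-- A physical class is a.e. gauge invariant. [cite: Luscher1983] -/
theorem ae_gaugeInv_of_mem_physL2 (g : Site 3 L → SU2) {v : Lp ℝ 2 (configMeasure SU2 L)} (hv : v ∈ physL2 L) :
    (fun U => (v : GaugeConfig 3 L SU2 → ℝ) (gaugeTransform g U)) =ᵐ[configMeasure SU2 L] (v : GaugeConfig 3 L SU2 → ℝ) :=
  ae_comp_eq_of_mem_physL2 (measurePreserving_gaugeTransform_configMeasure g) (fun _ hψ U => hψ.gaugeInv g U) hv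

/-- A physical class is a.e. invariant under the centre twists. [cite: tHooft1979] -/
theorem ae_twistInv_of_mem_physL2 (k : Fin 3) {z : SU2} (hz : z ∈ Subgroup.center SU2)
    {v : Lp ℝ 2 (configMeasure SU2 L)} (hv : v ∈ physL2 L) :
    (fun U => (v : GaugeConfig 3 L SU2 → ℝ) (twist k z U)) =ᵐ[configMeasure SU2 L] (v : GaugeConfig 3 L SU2 → ℝ) :=
  ae_comp_eq_of_mem_physL2 (measurePreserving_twist k z) (fun _ hψ U => hψ.zeroFlux k z hz U) hv

/-- **Physical representatives**: for a class `v` in the physical closed subspace, the everywhere-defined kernel integral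
`K_β v : U ↦ ∫ K_β(U,V) v(V) dV` is a physical zero-flux test function (measurable; bounded by `M √1 ‖v‖`; gauge and twist invariant by
the kernel symmetries, the invariance of the a-priori measure, and the a.e. invariance of `v`). [cite: Luscher1983] -/
theorem isPhys_transferApply_coe (β : ℝ) {v : Lp ℝ 2 (configMeasure SU2 L)} (hv : v ∈ physL2 L) :
    IsPhys (transferApply β (v : GaugeConfig 3 L SU2 → ℝ)) := by
  haveI : SecondCountableTopology SU2 := secondCountableTopology_su2
  obtain ⟨M, hM0, hM⟩ := exists_norm_transferKernel_le (L := L) β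
  have hvm : Measurable (v : GaugeConfig 3 L SU2 → ℝ) := (Lp.stronglyMeasurable v).measurable
  refine ⟨measurable_transferApply β hvm, ⟨M * Real.sqrt ((configMeasure SU2 L).real Set.univ) * ‖v‖, fun U => ?_⟩,
    fun g U => ?_, fun k z hz U => ?_⟩
  · rw [transferApply_apply]
    exact abs_integral_kernel_mul_le hM hM0 v U
  · -- gauge invariance
    rw [transferApply_apply, transferApply_apply]
    have hF : Measurable fun V => transferKernel su2Rep β (gaugeTransform g U) V * (v : GaugeConfig 3 L SU2 → ℝ) V :=
      (continuous_transferKernel_right β _).measurable.mul hvm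
    rw [← integral_comp_eq_of_measurePreserving (measurePreserving_gaugeTransform_configMeasure g) hF]
    refine integral_congr_ae ?_
    filter_upwards [ae_gaugeInv_of_mem_physL2 g hv] with V hV
    simp only [transferKernel_gaugeTransform, hV]
  · -- twist invariance
    rw [transferApply_apply, transferApply_apply]
    have hF : Measurable fun V => transferKernel su2Rep β (twist k z U) V * (v : GaugeConfig 3 L SU2 → ℝ) V :=
      (continuous_transferKernel_right β _).measurable.mul hvm
    rw [← integral_comp_eq_of_measurePreserving (measurePreserving_twist k z) hF]
    refine integral_congr_ae ?_
    filter_upwards [ae_twistInv_of_mem_physL2 k hz hv] with V hV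
    simp only [transferKernel_twist su2Rep β k hz, hV]

/-- The class of the physical representative `K_β v` is `A v`. [folklore] -/
theorem toL2_transferApply_coe {β : ℝ} {A : Lp ℝ 2 (configMeasure SU2 L) →L[ℝ] Lp ℝ 2 (configMeasure SU2 L)}
    (hA : ∀ v : Lp ℝ 2 (configMeasure SU2 L),
      (A v : GaugeConfig 3 L SU2 → ℝ) =ᵐ[configMeasure SU2 L] fun U => ∫ V, transferKernel su2Rep β U V * v V ∂configMeasure SU2 L)
    {v : Lp ℝ 2 (configMeasure SU2 L)} (hv : v ∈ physL2 L) :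
    toL2 ⟨transferApply β (v : GaugeConfig 3 L SU2 → ℝ), isPhys_transferApply_coe β hv⟩ = A v := by
  apply Lp.ext
  filter_upwards [coeFn_toL2 (⟨transferApply β (v : GaugeConfig 3 L SU2 → ℝ), isPhys_transferApply_coe β hv⟩ : physSubmodule L),
    hA v] with U h1 h2
  rw [h1, h2]
  rfl

end Summit.QuantumFields.YangMills.Theorems.FemtoTransferGap.PhysL2

end
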